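import Mathlib.Geometry.Manifold.Instances.Real
import Literature.Geometry.Riemannian.IsotropicCurvature
import Literature.Geometry.Riemannian.CurvatureOperator
import HarnessLib

/-!
# Hamilton's block decomposition `(A, B, C)` of the curvature of a 4-manifold in an orthonormal frame
(topic `Geometry/Riemannian`)

Definitional layer for the curvature pinching part (Hamilton 1997, §1.2 and §2 = Section B) of the
decomposition of `Literature.Geometry.Riemannian.hamilton_chen_tang_zhu` (`HamiltonPIC.lean`; Hamilton 1997,
Cor. 1.2(a)). In dimension four `Λ² = Λ²₊ ⊕ Λ²₋` and the curvature operator is a block matrix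
`(A B; ᵗB C)` (Hamilton 1997, p. 4); all of Hamilton's pinching estimates (§2, Thms. 1.1–2.x), the
neck analysis (§3) and Chen–Zhu's "restricted isotropic curvature pinching" (2006, (2.4)) are
phrased through the eigenvalues `a₁ ≤ a₂ ≤ a₃` of `A`, `c₁ ≤ c₂ ≤ c₃` of `C` and the singular
values `b₁ ≤ b₂ ≤ b₃` of `B`. This file makes the blocks real, frame-wise and without exterior
powers, following Hamilton's explicit bases (p. 5):

`φ₁ = X₁∧X₂ + X₃∧X₄`, `φ₂ = X₁∧X₃ + X₄∧X₂`, `φ₃ = X₁∧X₄ + X₂∧X₃` (basis of `Λ²₊`),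
`ψ₁ = X₁∧X₂ - X₃∧X₄`, `ψ₂ = X₁∧X₃ - X₄∧X₂`, `ψ₃ = X₁∧X₄ - X₂∧X₃` (basis of `Λ²₋`),

`A_{ij} = R(φᵢ, φⱼ)`, `B_{ij} = R(φᵢ, ψⱼ)`, `C_{ij} = R(ψᵢ, ψⱼ)`, where `R(X∧Y, Z∧W) = R_{XYZW}`
is Hamilton's curvature pairing of 2-vectors, positive on `X∧Y` paired with itself on the round
sphere; in terms of the tree's `curvatureForm` (`Rm(X,Y,Z,W) = g(R(X,Y)Z, W)`, for which
`Rm(X,Y,Y,X)` is the sectional numerator) this is `R(X∧Y, Z∧W) = Rm(X, Y, W, Z)`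
(`bivectorCurvature`), consistently with `curvatureOperatorForm` (`CurvatureOperator.lean`) and
with the `-2 R₁₂₃₄ = -2 Rm(e₁,e₂,e₄,e₃)` term of `isotropicCurvature` (`IsotropicCurvature.lean`).

## Contents

* `bivectorCurvature`, `pairingCurvature` (bilinear extension to formal sums of decomposable
  2-vectors given as lists of pairs), Hamilton's bases `selfDualPairs e`, `antiSelfDualPairs e`
  of an (orthonormal) 4-frame `e`, and the blocks `blockA g cov x e`, `blockB`, `blockC :
  Matrix (Fin 3) (Fin 3) ℝ`; the diagonal entries unfold to Hamilton's formulas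
  (`blockA_apply_zero_zero` : `A₁₁ = R₁₂₁₂ + R₃₄₃₄ + R₁₂₃₄ + R₃₄₁₂`, i.e. `+ 2R₁₂₃₄` under pair
  symmetry, etc.); `blockA_quadratic_eq`/`blockC_quadratic_eq`: `uᵀAu = R(φ_u, φ_u)`,
  `uᵀCu = R(ψ_u, ψ_u)` as `curvatureOperatorForm`s.
* `Matrix.TwoSmallestEigenvaluesSumGT A m` — "`a₁ + a₂ > m`" for a symmetric `3 × 3` matrix in
  Ky Fan's variational form `uᵀAu + vᵀAv > m` for all orthonormal pairs `u, v ∈ ℝ³` (the minimum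
  of the trace of a compression to a 2-plane is the sum of the two smallest eigenvalues), so no
  spectral theory is needed; `…SumPos A := …SumGT A 0`.
* NAMED FACT `hamilton_positiveIsotropicCurvature_iff_blocks` — **Hamilton 1997, §1.2,
  Lemma 2.1** (p. 5): "A four-manifold has positive isotropic curvature if and only if
  `a₁ + a₂ > 0` and `c₁ + c₂ > 0`" — vended frame-wise: PIC of `(g, cov)` iff for every
  orthonormal 4-frame `e` both `blockA` and `blockC` have `a₁ + a₂ > 0` (quantifying over all
  frames absorbs the orientation: reversing the orientation of `e` exchanges `A` and `C`).
* PROVED: `curvatureOperatorForm`-positivity gives `uᵀAu > 0`, `uᵀCu > 0` for `u ≠ 0`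
  (`HasPositiveCurvatureOperatorWith.blockA_quadratic_pos`), hence the block condition
  (`HasPositiveCurvatureOperatorWith.twoSmallestEigenvaluesSumPos_blockA/C`), and therefore
  **positive curvature operator implies positive isotropic curvature** modulo Hamilton's lemma
  (`HasPositiveCurvatureOperatorWith.hasPositiveIsotropicCurvatureWith`; Micallef–Moore 1988,
  Hamilton 1997 p. 6, Fraser–Wolfson 2006 p. 2: "Any manifold with … positive curvature
  operator has PIC").

## References

* R. S. Hamilton, *Four-manifolds with positive isotropic curvature*, Comm. Anal. Geom. 5 (1997)
  1–92, §1.2 (pp. 4–6: complex isotropic planes, the bases `φᵢ`, `ψᵢ`, the formulas for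
  `A_{ii}`, `C_{ii}`, `K(P) = A₂₂ + A₃₃`, Lemma 2.1). [Hamilton1997]
* R. S. Hamilton, *Four-manifolds with positive curvature operator*, J. Differential Geom. 24
  (1986), §1 (curvature operator on 2-forms) and "[3]" of Hamilton 1997 for the block form.
  [Hamilton1986]
* B.-L. Chen, X.-P. Zhu, J. Differential Geom. 74 (2006) (arXiv:math/0504478), §2, (2.1)–(2.4)
  (the same `(A, B, C)` notation). [ChenZhu2006]
-/

noncomputable section

open Bundle Finset Matrix
open scoped Manifold ContDiff Topology BigOperators

/-! ### `a₁ + a₂ > m` for a symmetric `3 × 3` matrix, variationally -/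

namespace Matrix

/-- **"The two smallest eigenvalues of `A` sum to more than `m`"**, for a real symmetric `3 × 3`
matrix `A`, in Ky Fan's variational form: `uᵀ A u + vᵀ A v > m` for every orthonormal pair
`u, v` of vectors of `ℝ³` (for symmetric `A` the minimum of `uᵀAu + vᵀAv = tr (A|_{span(u,v)})`
over orthonormal pairs is `a₁ + a₂`, the sum of the two smallest eigenvalues). This is how
Hamilton's conditions `a₁ + a₂ > 0`, `c₁ + c₂ > 0`, `a₁ + a₂ ≥ m` (1997, §1.2, Lemma 2.1; §2.1,
Thm. 1.2) are expressed without spectral theory. [folklore] -/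
def TwoSmallestEigenvaluesSumGT (A : Matrix (Fin 3) (Fin 3) ℝ) (m : ℝ) : Prop :=
  ∀ u v : Fin 3 → ℝ, u ⬝ᵥ u = 1 → v ⬝ᵥ v = 1 → u ⬝ᵥ v = 0 →
    m < u ⬝ᵥ (A *ᵥ u) + v ⬝ᵥ (A *ᵥ v)

/-- `a₁ + a₂ > 0` (Hamilton 1997, §1.2, Lemma 2.1). [folklore] -/
abbrev TwoSmallestEigenvaluesSumPos (A : Matrix (Fin 3) (Fin 3) ℝ) : Prop :=
  A.TwoSmallestEigenvaluesSumGT 0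

/-- Monotonicity in the threshold. [folklore] -/
theorem TwoSmallestEigenvaluesSumGT.mono {A : Matrix (Fin 3) (Fin 3) ℝ} {m m' : ℝ}
    (h : A.TwoSmallestEigenvaluesSumGT m) (hm : m' ≤ m) : A.TwoSmallestEigenvaluesSumGT m' :=
  fun u v hu hv huv ↦ hm.trans_lt (h u v hu hv huv)

/-- If the quadratic form of `A` is positive on nonzero vectors then `a₁ + a₂ > 0`. [folklore] -/
theorem twoSmallestEigenvaluesSumPos_of_quadratic_pos {A : Matrix (Fin 3) (Fin 3) ℝ}
    (h : ∀ u : Fin 3 → ℝ, u ≠ 0 → 0 < u ⬝ᵥ (A *ᵥ u)) : A.TwoSmallestEigenvaluesSumPos := by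
  intro u v hu hv _
  have hu0 : u ≠ 0 := by rintro rfl; simp at hu
  have hv0 : v ≠ 0 := by rintro rfl; simp at hv
  exact add_pos (h u hu0) (h v hv0)

end Matrix

namespace Literature.Geometry.Riemannian

section PseudoRiemannianMetric
open Literature.Geometry.Lorentzian (PseudoRiemannianMetric)
open Literature.Geometry.Lorentzian.PseudoRiemannianMetric

variable {E : Type*} [NormedAddCommGroup E] [NormedSpace ℝ E] {H : Type*} [TopologicalSpace H]
  {I : ModelWithCorners ℝ E H} {M : Type*} [TopologicalSpace M] [ChartedSpace H M]
  [IsManifold I ∞ M] {n : ℕ∞ω}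

variable (g : PseudoRiemannianMetric I n E (TangentSpace I : M → Type _))
  (cov : CovariantDerivative I E (TangentSpace I : M → Type _))

/-! ### Hamilton's curvature pairing of 2-vectors -/

/-- **Hamilton's curvature pairing of decomposable 2-vectors**, `R(X ∧ Y, Z ∧ W) := R_{XYZW}` in
the convention of Hamilton 1997, §1.2 (positive when `X ∧ Y = Z ∧ W` on the round sphere); in
terms of the tree's `curvatureForm` (`Rm(X,Y,Z,W) = g(R(X,Y)Z, W)`):
`R(X ∧ Y, Z ∧ W) = Rm(X, Y, W, Z)`. [cite: Hamilton1997, §1.2, pp. 4–5] -/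
def _root_.Literature.Geometry.Lorentzian.PseudoRiemannianMetric.bivectorCurvature (x : M) (X Y Z W : TangentSpace I x) : ℝ :=
  g.curvatureForm cov x X Y W Z

/-- On `X ∧ Y` paired with itself, Hamilton's pairing is the sectional numerator `Rm(X,Y,Y,X)`.
[cite: Hamilton1997, §1.2, p. 5] -/
@[simp] theorem _root_.Literature.Geometry.Lorentzian.PseudoRiemannianMetric.bivectorCurvature_self (x : M) (X Y : TangentSpace I x) :
    g.bivectorCurvature cov x X Y X Y = g.curvatureForm cov x X Y Y X := rfl

/-- The pairing extended bilinearly to formal sums of decomposable 2-vectors, given as finite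
lists of pairs: `R(Σₐ Xₐ∧Yₐ, Σ_b Z_b∧W_b) = Σ_{a,b} R(Xₐ∧Yₐ, Z_b∧W_b)`.
[cite: Hamilton1997, §1.2, p. 5] -/
def _root_.Literature.Geometry.Lorentzian.PseudoRiemannianMetric.pairingCurvature (x : M) {p q : ℕ} (φ : Fin p → TangentSpace I x × TangentSpace I x)
    (ψ : Fin q → TangentSpace I x × TangentSpace I x) : ℝ :=
  ∑ a, ∑ b, g.bivectorCurvature cov x (φ a).1 (φ a).2 (ψ b).1 (ψ b).2

/-- `R(φ, φ)` in the list form is the curvature-operator quadratic form `curvatureOperatorForm`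
of `CurvatureOperator.lean`. [folklore] -/
theorem _root_.Literature.Geometry.Lorentzian.PseudoRiemannianMetric.pairingCurvature_self_eq_curvatureOperatorForm (x : M) {p : ℕ}
    (φ : Fin p → TangentSpace I x × TangentSpace I x) :
    g.pairingCurvature cov x φ φ =
      g.curvatureOperatorForm cov x (fun a ↦ (φ a).1) (fun a ↦ (φ a).2) := rfl

/-! ### Hamilton's bases of `Λ²₊` and `Λ²₋` attached to a 4-frame -/

/-- Hamilton's basis of self-dual 2-vectors attached to the 4-frame `e = (X₁, X₂, X₃, X₄)`
(1997, p. 5): `φ₁ = X₁∧X₂ + X₃∧X₄`, `φ₂ = X₁∧X₃ + X₄∧X₂`, `φ₃ = X₁∧X₄ + X₂∧X₃`, each as a list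
of two pairs. [cite: Hamilton1997, §1.2, p. 5] -/
def _root_.Literature.Geometry.Lorentzian.PseudoRiemannianMetric.selfDualPairs {x : M} (e : Fin 4 → TangentSpace I x) :
    Fin 3 → Fin 2 → TangentSpace I x × TangentSpace I x :=
  ![![(e 0, e 1), (e 2, e 3)], ![(e 0, e 2), (e 3, e 1)], ![(e 0, e 3), (e 1, e 2)]]

/-- Hamilton's basis of anti-self-dual 2-vectors attached to `e` (1997, p. 5):
`ψ₁ = X₁∧X₂ - X₃∧X₄`, `ψ₂ = X₁∧X₃ - X₄∧X₂`, `ψ₃ = X₁∧X₄ - X₂∧X₃`, written with the signs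
absorbed (`-X₃∧X₄ = X₄∧X₃`, …). [cite: Hamilton1997, §1.2, p. 5] -/
def _root_.Literature.Geometry.Lorentzian.PseudoRiemannianMetric.antiSelfDualPairs {x : M} (e : Fin 4 → TangentSpace I x) :
    Fin 3 → Fin 2 → TangentSpace I x × TangentSpace I x :=
  ![![(e 0, e 1), (e 3, e 2)], ![(e 0, e 2), (e 1, e 3)], ![(e 0, e 3), (e 2, e 1)]]

/-! ### The blocks `A`, `B`, `C` -/

/-- **Hamilton's block `A`** of the curvature of `(g, cov)` at `x` in the 4-frame `e`:
`A_{ij} = R(φᵢ, φⱼ)` (1997, p. 4: `M = (A B; ᵗB C)`; p. 5). [cite: Hamilton1997, §1.2, pp. 4–5] -/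
def _root_.Literature.Geometry.Lorentzian.PseudoRiemannianMetric.blockA (x : M) (e : Fin 4 → TangentSpace I x) : Matrix (Fin 3) (Fin 3) ℝ :=
  Matrix.of fun i j ↦ g.pairingCurvature cov x (selfDualPairs e i) (selfDualPairs e j)

/-- **Hamilton's block `B`**: `B_{ij} = R(φᵢ, ψⱼ)` (1997, pp. 4–5; it "gives the traceless
Ricci tensor", p. 6). [cite: Hamilton1997, §1.2, pp. 4–6] -/
def _root_.Literature.Geometry.Lorentzian.PseudoRiemannianMetric.blockB (x : M) (e : Fin 4 → TangentSpace I x) : Matrix (Fin 3) (Fin 3) ℝ :=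
  Matrix.of fun i j ↦ g.pairingCurvature cov x (selfDualPairs e i) (antiSelfDualPairs e j)

/-- **Hamilton's block `C`**: `C_{ij} = R(ψᵢ, ψⱼ)` (1997, pp. 4–5). [cite: Hamilton1997, §1.2, pp. 4–5] -/
def _root_.Literature.Geometry.Lorentzian.PseudoRiemannianMetric.blockC (x : M) (e : Fin 4 → TangentSpace I x) : Matrix (Fin 3) (Fin 3) ℝ :=
  Matrix.of fun i j ↦ g.pairingCurvature cov x (antiSelfDualPairs e i) (antiSelfDualPairs e j)

section Formulas

variable (x : M) (e : Fin 4 → TangentSpace I x)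

/-- Shorthand in this section: `R i j k l = R(Xᵢ∧Xⱼ, X_k∧X_l)` (Hamilton's `R_{ijkl}`, indices
from `0`). -/
local notation "R[" i "," j "," k "," l "]" => g.bivectorCurvature cov x (e i) (e j) (e k) (e l)

/-- `A₁₁ = R₁₂₁₂ + R₃₄₃₄ + R₁₂₃₄ + R₃₄₁₂` (Hamilton, p. 5: `= R₁₂₁₂ + R₃₄₃₄ + 2R₁₂₃₄` by pair
symmetry). [cite: Hamilton1997, §1.2, p. 5] -/
theorem _root_.Literature.Geometry.Lorentzian.PseudoRiemannianMetric.blockA_apply_zero_zero :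
    g.blockA cov x e 0 0 = R[0,1,0,1] + R[2,3,2,3] + R[0,1,2,3] + R[2,3,0,1] := by
  simp [blockA, pairingCurvature, selfDualPairs, Fin.sum_univ_two]
  ring

/-- `A₂₂ = R₁₃₁₃ + R₄₂₄₂ + R₁₃₄₂ + R₄₂₁₃` (Hamilton: `+ 2R₁₃₄₂`). [cite: Hamilton1997, §1.2, p. 5] -/
theorem _root_.Literature.Geometry.Lorentzian.PseudoRiemannianMetric.blockA_apply_one_one :
    g.blockA cov x e 1 1 = R[0,2,0,2] + R[3,1,3,1] + R[0,2,3,1] + R[3,1,0,2] := by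
  simp [blockA, pairingCurvature, selfDualPairs, Fin.sum_univ_two]
  ring

/-- `A₃₃ = R₁₄₁₄ + R₂₃₂₃ + R₁₄₂₃ + R₂₃₁₄` (Hamilton: `+ 2R₁₄₂₃`). [cite: Hamilton1997, §1.2, p. 5] -/
theorem _root_.Literature.Geometry.Lorentzian.PseudoRiemannianMetric.blockA_apply_two_two :
    g.blockA cov x e 2 2 = R[0,3,0,3] + R[1,2,1,2] + R[0,3,1,2] + R[1,2,0,3] := by
  simp [blockA, pairingCurvature, selfDualPairs, Fin.sum_univ_two]
  ring

/-- `C₁₁ = R₁₂₁₂ + R₄₃₄₃ + R₁₂₄₃ + R₄₃₁₂` (Hamilton: `R₁₂₁₂ + R₃₄₃₄ - 2R₁₂₃₄`).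
[cite: Hamilton1997, §1.2, p. 5] -/
theorem _root_.Literature.Geometry.Lorentzian.PseudoRiemannianMetric.blockC_apply_zero_zero :
    g.blockC cov x e 0 0 = R[0,1,0,1] + R[3,2,3,2] + R[0,1,3,2] + R[3,2,0,1] := by
  simp [blockC, pairingCurvature, antiSelfDualPairs, Fin.sum_univ_two]
  ring

end Formulas

/-! ### Named fact: Hamilton's characterization of PIC by the blocks (1997, §1.2, Lemma 2.1) -/

end PseudoRiemannianMetric

end Literature.Geometry.Riemannian

namespace Literature.Geometry.Riemannian

open Lorentzian Lorentzian.PseudoRiemannianMetric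

universe u

/-- NAMED FACT (**Hamilton 1997, §1.2, Lemma 2.1**, p. 5: "A four-manifold has positive
isotropic curvature if and only if `a₁ + a₂ > 0` and `c₁ + c₂ > 0` where `a₁` and `a₂` are the
two smallest eigenvalues of the matrix `A`, and `c₁` and `c₂` are the two smallest eigenvalues
of the matrix `C`" — derived on p. 5 from `K(P) = R₁₃₁₃ + R₁₄₁₄ + R₂₃₂₃ + R₂₄₂₄ - 2R₁₂₃₄ =
A₂₂ + A₃₃` for a positively oriented orthonormal basis, `= C₂₂ + C₃₃` for the opposite
orientation, using the Bianchi identity `R₁₂₃₄ + R₁₃₄₂ + R₁₄₂₃ = 0`). Vended frame-wise, for a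
Riemannian metric `g` on a smooth 4-manifold and a Levi-Civita connection `cov` of `g`:
`(g, cov)` has positive isotropic curvature (`HasPositiveIsotropicCurvatureWith`, the frame
condition `K₁₃ + K₁₄ + K₂₃ + K₂₄ - 2R₁₂₃₄ > 0`) iff for every point `x` and every
`g`-orthonormal 4-frame `e` at `x` the blocks `A = blockA g cov x e` and `C = blockC g cov x e`
both satisfy `a₁ + a₂ > 0` (`Matrix.TwoSmallestEigenvaluesSumPos`, Ky Fan form); quantifying
over all orthonormal frames replaces the choice of an orientation. Users take
`(h : hamilton_positiveIsotropicCurvature_iff_blocks)`. [cite: Hamilton1997, §1.2, Lemma 2.1 (p. 5)] -/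
def hamilton_positiveIsotropicCurvature_iff_blocks : Prop :=
  ∀ (M : Type u) [TopologicalSpace M] [ChartedSpace (EuclideanSpace ℝ (Fin 4)) M]
    [IsManifold (𝓡 4) ∞ M]
    (g : PseudoRiemannianMetric (𝓡 4) ∞ (EuclideanSpace ℝ (Fin 4)) (TangentSpace (𝓡 4) : M → Type _))
    (cov : CovariantDerivative (𝓡 4) (EuclideanSpace ℝ (Fin 4)) (TangentSpace (𝓡 4) : M → Type _)),
    g.IsRiemannian → g.IsLeviCivita cov →
      (g.HasPositiveIsotropicCurvatureWith cov ↔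
        ∀ (x : M) (e : Fin 4 → TangentSpace (𝓡 4) x), g.IsOrthonormalFrame x e →
          (g.blockA cov x e).TwoSmallestEigenvaluesSumPos ∧
            (g.blockC cov x e).TwoSmallestEigenvaluesSumPos)

/-! ### Positive curvature operator and the blocks (proved) -/

section PCO

variable {E : Type*} [NormedAddCommGroup E] [NormedSpace ℝ E] {H : Type*} [TopologicalSpace H]
  {I : ModelWithCorners ℝ E H} {M : Type*} [TopologicalSpace M] [ChartedSpace H M]
  [IsManifold I ∞ M] {n : ℕ∞ω}
  {g : PseudoRiemannianMetric I n E (TangentSpace I : M → Type _)}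
  {cov : CovariantDerivative I E (TangentSpace I : M → Type _)}

/-- The six first factors `uᵢ Xₐ` of the decomposable terms of `φ_u = Σᵢ uᵢ φᵢ`
(`φ₁ = X₁∧X₂ + X₃∧X₄`, `φ₂ = X₁∧X₃ + X₄∧X₂`, `φ₃ = X₁∧X₄ + X₂∧X₃`), in the order
`(1,2), (3,4), (1,3), (4,2), (1,4), (2,3)`. [cite: Hamilton1997, §1.2, p. 5] -/
def selfDualCombFst {x : M} (e : Fin 4 → TangentSpace I x) (u : Fin 3 → ℝ) :
    Fin 6 → TangentSpace I x :=
  ![u 0 • e 0, u 0 • e 2, u 1 • e 0, u 1 • e 3, u 2 • e 0, u 2 • e 1]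

/-- The six second factors of the decomposable terms of `φ_u = Σᵢ uᵢ φᵢ`. [cite: Hamilton1997, §1.2, p. 5] -/
def selfDualCombSnd {x : M} (e : Fin 4 → TangentSpace I x) : Fin 6 → TangentSpace I x :=
  ![e 1, e 3, e 2, e 1, e 3, e 2]

/-- **`uᵀ A u = R(φ_u, φ_u)`**: the quadratic form of Hamilton's block `A` at `u ∈ ℝ³` is the
curvature-operator quadratic form (`curvatureOperatorForm`, `CurvatureOperator.lean`) of the
self-dual 2-vector `φ_u = Σᵢ uᵢ φᵢ`, written as the sum of six decomposable 2-vectors.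
[cite: Hamilton1997, §1.2, p. 5] -/
theorem blockA_quadratic_eq (x : M) (e : Fin 4 → TangentSpace I x) (u : Fin 3 → ℝ) :
    u ⬝ᵥ (g.blockA cov x e *ᵥ u) =
      g.curvatureOperatorForm cov x (selfDualCombFst e u) (selfDualCombSnd e) := by
  simp only [blockA, pairingCurvature, bivectorCurvature, curvatureForm, selfDualPairs,
    curvatureOperatorForm, selfDualCombFst, selfDualCombSnd, Matrix.mulVec, dotProduct,
    Matrix.of_apply, Fin.sum_univ_succ, Fin.sum_univ_zero, Matrix.cons_val_zero, Fin.isValue]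
  simp only [map_smul, _root_.smul_apply, smul_eq_mul]
  simp
  ring

/-- For an orthonormal frame, the alternating form of `φ_u` evaluated on `(X₁, X₂)`, `(X₁, X₃)`,
`(X₁, X₄)` recovers the coefficients `u₁, u₂, u₃`; in particular `φ_u ≠ 0` for `u ≠ 0`.
[cite: Hamilton1997, §1.2, p. 5] -/
theorem bivectorForm_selfDualComb (x : M) {e : Fin 4 → TangentSpace I x}
    (he : g.IsOrthonormalFrame x e) (u : Fin 3 → ℝ) (i : Fin 3) :
    g.bivectorForm x (selfDualCombFst e u) (selfDualCombSnd e) (e 0) (e i.succ) = u i := by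
  obtain ⟨h1, h2⟩ := he
  have h01 := h2 0 1 (by decide); have h02 := h2 0 2 (by decide); have h03 := h2 0 3 (by decide)
  have h10 := h2 1 0 (by decide); have h12 := h2 1 2 (by decide); have h13 := h2 1 3 (by decide)
  have h20 := h2 2 0 (by decide); have h21 := h2 2 1 (by decide); have h23 := h2 2 3 (by decide)
  have h30 := h2 3 0 (by decide); have h31 := h2 3 1 (by decide); have h32 := h2 3 2 (by decide)
  fin_cases i <;>
    simp [bivectorForm, selfDualCombFst, selfDualCombSnd, Fin.sum_univ_succ, map_smul,
      _root_.smul_apply, smul_eq_mul, h1 0, h1 1, h1 2, h1 3, h01, h02, h03, h10, h12, h13, h20,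
      h21, h23, h30, h31, h32]

/-- **Positive curvature operator makes the block `A` positive definite**: `uᵀ A u > 0` for
`u ≠ 0`, in every orthonormal frame (apply the definition to `φ_u`). [cite: Hamilton1997, §1.2, pp. 5–6] -/
theorem _root_.Literature.Geometry.Lorentzian.PseudoRiemannianMetric.HasPositiveCurvatureOperatorWith.blockA_quadratic_pos
    (h : g.HasPositiveCurvatureOperatorWith cov) (x : M) {e : Fin 4 → TangentSpace I x}
    (he : g.IsOrthonormalFrame x e) {u : Fin 3 → ℝ} (hu : u ≠ 0) :
    0 < u ⬝ᵥ (g.blockA cov x e *ᵥ u) := by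
  rw [blockA_quadratic_eq]
  apply h
  obtain ⟨i, hi⟩ : ∃ i, u i ≠ 0 := Function.ne_iff.mp hu
  exact ⟨e 0, e i.succ, by rwa [bivectorForm_selfDualComb x he u i]⟩


/-- The six first factors of the decomposable terms of `ψ_u = Σᵢ uᵢ ψᵢ`
(`ψ₁ = X₁∧X₂ - X₃∧X₄`, `ψ₂ = X₁∧X₃ - X₄∧X₂`, `ψ₃ = X₁∧X₄ - X₂∧X₃`, signs absorbed as in
`antiSelfDualPairs`). [cite: Hamilton1997, §1.2, p. 5] -/
def antiSelfDualCombFst {x : M} (e : Fin 4 → TangentSpace I x) (u : Fin 3 → ℝ) :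
    Fin 6 → TangentSpace I x :=
  ![u 0 • e 0, u 0 • e 3, u 1 • e 0, u 1 • e 1, u 2 • e 0, u 2 • e 2]

/-- The six second factors of the decomposable terms of `ψ_u`. [cite: Hamilton1997, §1.2, p. 5] -/
def antiSelfDualCombSnd {x : M} (e : Fin 4 → TangentSpace I x) : Fin 6 → TangentSpace I x :=
  ![e 1, e 2, e 2, e 3, e 3, e 1]

/-- **`uᵀ C u = R(ψ_u, ψ_u)`**, the analogue of `blockA_quadratic_eq` for the block `C`.
[cite: Hamilton1997, §1.2, p. 5] -/
theorem blockC_quadratic_eq (x : M) (e : Fin 4 → TangentSpace I x) (u : Fin 3 → ℝ) :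
    u ⬝ᵥ (g.blockC cov x e *ᵥ u) =
      g.curvatureOperatorForm cov x (antiSelfDualCombFst e u) (antiSelfDualCombSnd e) := by
  simp only [blockC, pairingCurvature, bivectorCurvature, curvatureForm, antiSelfDualPairs,
    curvatureOperatorForm, antiSelfDualCombFst, antiSelfDualCombSnd, Matrix.mulVec, dotProduct,
    Matrix.of_apply, Fin.sum_univ_succ, Fin.sum_univ_zero, Matrix.cons_val_zero, Fin.isValue]
  simp only [map_smul, _root_.smul_apply, smul_eq_mul]
  simp
  ring

/-- For an orthonormal frame, `ψ_u♭(X₁, X_{i+1}) = uᵢ`; in particular `ψ_u ≠ 0` for `u ≠ 0`.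
[cite: Hamilton1997, §1.2, p. 5] -/
theorem bivectorForm_antiSelfDualComb (x : M) {e : Fin 4 → TangentSpace I x}
    (he : g.IsOrthonormalFrame x e) (u : Fin 3 → ℝ) (i : Fin 3) :
    g.bivectorForm x (antiSelfDualCombFst e u) (antiSelfDualCombSnd e) (e 0) (e i.succ) = u i := by
  obtain ⟨h1, h2⟩ := he
  have h01 := h2 0 1 (by decide); have h02 := h2 0 2 (by decide); have h03 := h2 0 3 (by decide)
  have h10 := h2 1 0 (by decide); have h12 := h2 1 2 (by decide); have h13 := h2 1 3 (by decide)
  have h20 := h2 2 0 (by decide); have h21 := h2 2 1 (by decide); have h23 := h2 2 3 (by decide)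
  have h30 := h2 3 0 (by decide); have h31 := h2 3 1 (by decide); have h32 := h2 3 2 (by decide)
  fin_cases i <;>
    simp [bivectorForm, antiSelfDualCombFst, antiSelfDualCombSnd, Fin.sum_univ_succ, map_smul,
      _root_.smul_apply, smul_eq_mul, h1 0, h1 1, h1 2, h1 3, h01, h02, h03, h10, h12, h13, h20,
      h21, h23, h30, h31, h32]

/-- Positive curvature operator makes the block `C` positive definite in every orthonormal frame.
[cite: Hamilton1997, §1.2, pp. 5–6] -/
theorem _root_.Literature.Geometry.Lorentzian.PseudoRiemannianMetric.HasPositiveCurvatureOperatorWith.blockC_quadratic_pos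
    (h : g.HasPositiveCurvatureOperatorWith cov) (x : M) {e : Fin 4 → TangentSpace I x}
    (he : g.IsOrthonormalFrame x e) {u : Fin 3 → ℝ} (hu : u ≠ 0) :
    0 < u ⬝ᵥ (g.blockC cov x e *ᵥ u) := by
  rw [blockC_quadratic_eq]
  apply h
  obtain ⟨i, hi⟩ : ∃ i, u i ≠ 0 := Function.ne_iff.mp hu
  exact ⟨e 0, e i.succ, by rwa [bivectorForm_antiSelfDualComb x he u i]⟩

/-- Hence `a₁ + a₂ > 0` for the block `A` of a pair with positive curvature operator, in every
orthonormal frame. [cite: Hamilton1997, §1.2, Lemma 2.1 (p. 5)] -/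
theorem _root_.Literature.Geometry.Lorentzian.PseudoRiemannianMetric.HasPositiveCurvatureOperatorWith.twoSmallestEigenvaluesSumPos_blockA
    (h : g.HasPositiveCurvatureOperatorWith cov) (x : M) {e : Fin 4 → TangentSpace I x}
    (he : g.IsOrthonormalFrame x e) : (g.blockA cov x e).TwoSmallestEigenvaluesSumPos :=
  Matrix.twoSmallestEigenvaluesSumPos_of_quadratic_pos fun _ hu ↦ h.blockA_quadratic_pos x he hu

/-- … and `c₁ + c₂ > 0` for the block `C`. [cite: Hamilton1997, §1.2, Lemma 2.1 (p. 5)] -/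
theorem _root_.Literature.Geometry.Lorentzian.PseudoRiemannianMetric.HasPositiveCurvatureOperatorWith.twoSmallestEigenvaluesSumPos_blockC
    (h : g.HasPositiveCurvatureOperatorWith cov) (x : M) {e : Fin 4 → TangentSpace I x}
    (he : g.IsOrthonormalFrame x e) : (g.blockC cov x e).TwoSmallestEigenvaluesSumPos :=
  Matrix.twoSmallestEigenvaluesSumPos_of_quadratic_pos fun _ hu ↦ h.blockC_quadratic_pos x he hu

end PCO

/-- **Positive curvature operator implies positive isotropic curvature** in dimension four
(Micallef–Moore 1988; Hamilton 1997, p. 6; Fraser–Wolfson 2006, p. 2: "Any manifold with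
pointwise quarter-pinched sectional curvatures or positive curvature operator has PIC"), proved
here modulo Hamilton's Lemma 2.1 taken as the hypothesis `hL`: positive curvature operator makes
`A` and `C` positive definite in every orthonormal frame
(`HasPositiveCurvatureOperatorWith.twoSmallestEigenvaluesSumPos_blockA/C`), in particular
`a₁ + a₂ > 0` and `c₁ + c₂ > 0`. [cite: Hamilton1997, §1.2, Lemma 2.1 (p. 5) and p. 6] -/
theorem hasPositiveIsotropicCurvatureWith_of_hasPositiveCurvatureOperatorWith
    (hL : hamilton_positiveIsotropicCurvature_iff_blocks.{u})
    (M : Type u) [TopologicalSpace M] [ChartedSpace (EuclideanSpace ℝ (Fin 4)) M]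
    [IsManifold (𝓡 4) ∞ M]
    (g : PseudoRiemannianMetric (𝓡 4) ∞ (EuclideanSpace ℝ (Fin 4)) (TangentSpace (𝓡 4) : M → Type _))
    (cov : CovariantDerivative (𝓡 4) (EuclideanSpace ℝ (Fin 4)) (TangentSpace (𝓡 4) : M → Type _))
    (hg : g.IsRiemannian) (hcov : g.IsLeviCivita cov) (h : g.HasPositiveCurvatureOperatorWith cov) :
    g.HasPositiveIsotropicCurvatureWith cov :=
  (hL M g cov hg hcov).2 fun x _ he ↦
    ⟨h.twoSmallestEigenvaluesSumPos_blockA x he, h.twoSmallestEigenvaluesSumPos_blockC x he⟩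

/-- The same for the metric-level notions: a Riemannian metric with positive curvature operator
on a smooth 4-manifold has positive isotropic curvature (modulo Hamilton's Lemma 2.1).
[cite: Hamilton1997, §1.2, Lemma 2.1 (p. 5) and p. 6] -/
theorem hasPositiveIsotropicCurvature_of_hasPositiveCurvatureOperator
    (hL : hamilton_positiveIsotropicCurvature_iff_blocks.{u})
    (M : Type u) [TopologicalSpace M] [ChartedSpace (EuclideanSpace ℝ (Fin 4)) M]
    [IsManifold (𝓡 4) ∞ M]
    (g : PseudoRiemannianMetric (𝓡 4) ∞ (EuclideanSpace ℝ (Fin 4)) (TangentSpace (𝓡 4) : M → Type _))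
    (hg : g.IsRiemannian) (h : g.HasPositiveCurvatureOperator) :
    g.HasPositiveIsotropicCurvature :=
  fun cov hcov ↦ hasPositiveIsotropicCurvatureWith_of_hasPositiveCurvatureOperatorWith hL M g cov
    hg hcov (h cov hcov)

end Literature.Geometry.Riemannian

end
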